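import Literature.NumberTheory.Transcendental.QuadraticRelationsLogarithmsWeilHeight

/-!
# Nesterenko–Waldschmidt 1996, Theorem 5 (1): an explicit lower bound for `|e^β − α|`, `α, β` algebraic

Yu. V. Nesterenko, M. Waldschmidt, *On the approximation of the values of exponential function and
logarithm by algebraic numbers*, Mat. Zapiski 2 (1996) 23–42 (= arXiv:math/0002047), Theorem 5 (1),
p. 2 of the arXiv version. NAMED FACT (statement only, not proved here); users take
`(h : NesterenkoWaldschmidt1996_thm_5_1)`.

The absolute logarithmic Weil height `h(x)` of an algebraic number `x` is written with the tree's
`Literature.NumberTheory.Transcendental.weilHeight₁` computed in the number field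
`K = ℚ(α, β)` (the height is field-independent; `weilHeight₁_root_eq` in
`QuadraticRelationsLogarithmsMahlerWeil.lean` identifies it with `log M(P)/deg P` for a root of an
irreducible `P ∈ ℤ[X]`). `D = [ℚ(α, β) : ℚ]`; `log₊ x = log max(1, x)`; `|β|` = the complex modulus.

Consumer: the decomp-schanuel cell's route `RootDecomp1K` (lens-6 «HyperLiouvilleCell»: explicit
rational case `β = r ∈ ℚ×`, `α` a root of an irreducible integer polynomial), per the cell critic's
ruling 2026-08-30T12:10:34Z (b′).
-/

namespace Literature.NumberTheory.Transcendental

/-- **Nesterenko–Waldschmidt 1996, Theorem 5 (1)** (Mat. Zapiski 2 (1996) 23–42 = arXiv:math/0002047,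
p. 2): "Let `α` and `β` be algebraic numbers; define `K = ℚ(α, β)` and `D = [K : ℚ]`. Let `A` and `E` be
positive real numbers satisfying `E ≥ e` and `log A ≥ max(h(α), D⁻¹ log E, D⁻¹ |β| E)`.
1) If `β ≠ 0`, then
`|e^β − α| ≥ exp(−105500 · D² log A · (h(β) + log₊ log A + log D + log E) · (D log D + log E) · (log E)⁻²)`,
where `log₊ x = log max(1, x)`." Here `h` = the absolute logarithmic Weil height (`weilHeight₁` computed
in `K`), `|β|` = the complex modulus, `e^β − α` read in `ℂ`. NAMED FACT, not proved here; users take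
`(h : NesterenkoWaldschmidt1996_thm_5_1)`.
[cite: NesterenkoWaldschmidt1996, Theorem 5 (1)] [file NumberTheory/Transcendental/ExpAlgebraicApproximationMeasure] -/
def NesterenkoWaldschmidt1996_thm_5_1 : Prop :=
  ∀ (α β : ℂ), IsAlgebraic ℚ α → IsAlgebraic ℚ β → β ≠ 0 →
    ∀ (A E : ℝ), 0 < A → 0 < E → Real.exp 1 ≤ E →
      max (weilHeight₁ (IntermediateField.adjoin ℚ ({α, β} : Set ℂ)) ![α])
          (max ((Module.finrank ℚ (IntermediateField.adjoin ℚ ({α, β} : Set ℂ)) : ℝ)⁻¹ * Real.log E)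
            ((Module.finrank ℚ (IntermediateField.adjoin ℚ ({α, β} : Set ℂ)) : ℝ)⁻¹ * ‖β‖ * E))
        ≤ Real.log A →
      Real.exp (-(105500 * ((Module.finrank ℚ (IntermediateField.adjoin ℚ ({α, β} : Set ℂ)) : ℝ)) ^ 2 *
          Real.log A *
          (weilHeight₁ (IntermediateField.adjoin ℚ ({α, β} : Set ℂ)) ![β] + Real.log (max 1 (Real.log A)) +
            Real.log (Module.finrank ℚ (IntermediateField.adjoin ℚ ({α, β} : Set ℂ)) : ℝ) + Real.log E) *
          (((Module.finrank ℚ (IntermediateField.adjoin ℚ ({α, β} : Set ℂ)) : ℝ)) *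
              Real.log (Module.finrank ℚ (IntermediateField.adjoin ℚ ({α, β} : Set ℂ)) : ℝ) + Real.log E) /
          Real.log E ^ 2)) ≤
        ‖Complex.exp β - α‖

end Literature.NumberTheory.Transcendental
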